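import Summits.ABC.IUTFork.Cor312NaiveThm311
import Summits.ABC.IUTFork.Cor312PinnedRegionsTwist
import HarnessLib

/-!
# [IUTchIII] Cor. 3.12 — the C-13 coricity cost `hfrob` is GENUINE: a situation with the full étale
symmetry where NO admissible transport identifies the columns' Kummer images

Record-only file (D-0012) of the abc-iut cell (D-0067 Cor. 3.12 strategy TEAM C «étale-picture /
multiradiality», seat abc-iut-c312-13, row C-13c of `HOME/plan/C312-TEAMS.md`); TAKES NO SIDE.
Companion of C-13b (`Cor312PinnedFrobCompatNaive.lean`): there, the cross-column Kummer
identification `hfrob` — the one cost of the pinned reading's étale coricity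
(`thetaPinned_recolumn_of_frobCompat`, row C-13) — HOLDS at the naive base; HERE it FAILS, so the
pair shows `hfrob` is a genuine hypothesis: neither vacuous nor automatic. The witness
`depthLattice` keeps the naive data (a)(b)(c) of every line (so `MultiradialCompat` HOLDS —
`depthLattice_multiradialCompat`: the étale-picture symmetry is fully present, with `Φ = 1`
realising every column transport) but makes the columns' Kummer images COLUMN-DEPENDENT: column `0`
carries the full splitting monoid `Ψ_v` (both sign translates of the theta values), every other
column only the singleton `{θ_v}` (`depthCol`). Since every admissible `Φ ∈ ⟨(Ind1) ∪ (Ind2)⟩` acts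
by signs and `Ψ_v` is sign-saturated, `starAut Φ '' Ψ_v = Ψ_v ≠ {θ_v}` — so `hfrob` fails between
columns `0` and `1` for EVERY admissible transport (`depth_not_frobCompat`), although transports
realising the data identification exist (`MRData.map_one`). CONSEQUENCE: `MultiradialCompat` does
NOT imply the cross-column Kummer identification — C-13's `hfrob` is strictly extra data over the
typed Thm. 3.11 (i) étale symmetry; together with C-13b, the pinned reading's étale coricity cost is
CONTENTFUL (satisfiable, failable, implied by nothing frozen). HONEST SCOPE: `depthLattice` claims
no clause of typed Thm. 3.11 beyond the (i)-symmetry exhibited; its columns are bookkeeping data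
chosen to separate the identification from the symmetry — which is the point: print's log-Kummer
correspondence (Thm. 3.11 (ii), p. 154–156) is exactly what would have to supply `hfrob`, and that
supply is a clause about the COLUMNS, not about the data (a)(b)(c). Nothing here asserts any pin
holds for any setting, and nothing here asserts Cor. 3.12. [claim: Mochizuki2012, status: disputed]
for the quoted clauses; proofs are [folklore] bookkeeping over the landed naive-witness API.
-/

noncomputable section

namespace Summit.ABC.IUTFork.Cor312Vol.NaiveWitness

open Thm311 Cor312 Cor312.Checks Cor312.IdentifiedNonVacuity Literature.IUT.LogThetaLattice

variable (p : ℕ) [hp : Fact p.Prime]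

/-- The `n`-th DEPTH column: the naive column with the Kummer image of the splitting monoid made
COLUMN-DEPENDENT — the full sign-saturated `Ψ_v` at `n = 0`, the bare theta-value singleton
`{θ_v}` at every other column (bookkeeping data; no Thm. 3.11 clause claimed).
[claim: Mochizuki2012, status: disputed] -/
def depthCol (n : ℤ) : Thm311.Column signShells :=
  { naiveColumn p with
    frobΨ := fun _ v _ => {f | f ∈ Psi p v ∧ (n = 0 ∨ f = thetaValues p v)} }

/-- The DEPTH lattice situation: the naive situation (same data (a)(b)(c) on every line) with the
depth columns. [claim: Mochizuki2012, status: disputed] -/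
def depthLattice : LatticeSituation toyIndex :=
  { (naiveFull p).toLatticeSituation with col := depthCol p }

omit hp in
/-- Column `0`'s Kummer image is the full splitting monoid. [folklore] -/
theorem depthCol_zero_frobΨ (m : ℤ) (v : toyIndex.V) (hv : v ∈ toyIndex.Vbad) :
    ((depthLattice p).col 0).frobΨ m v hv = Psi p v := by
  ext f
  show f ∈ Psi p v ∧ ((0 : ℤ) = 0 ∨ f = thetaValues p v) ↔ f ∈ Psi p v
  exact ⟨fun h => h.1, fun h => ⟨h, Or.inl rfl⟩⟩

omit hp in
/-- Column `1`'s Kummer image is the theta-value singleton. [folklore] -/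
theorem depthCol_one_frobΨ (m : ℤ) (v : toyIndex.V) (hv : v ∈ toyIndex.Vbad) :
    ((depthLattice p).col 1).frobΨ m v hv = {thetaValues p v} := by
  ext f
  show f ∈ Psi p v ∧ ((1 : ℤ) = 0 ∨ f = thetaValues p v) ↔ f = thetaValues p v
  constructor
  · rintro ⟨-, h1 | hθ⟩
    · exact absurd h1 one_ne_zero
    · exact hθ
  · rintro rfl
    exact ⟨thetaValues_mem_Psi p v, Or.inr rfl⟩

omit hp in
/-- **The depth situation has the FULL étale-picture symmetry** (typed Thm. 3.11 (i)): its data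
(a)(b)(c) are the naive line data, constant in `n`, so `Φ = 1` realises every column transport.
[folklore] -/
theorem depthLattice_multiradialCompat : (depthLattice p).toSituation.MultiradialCompat :=
  (Situation.multiradialCompat_iff_indGroup _).mpr fun _ _ =>
    ⟨1, one_mem _, (MRData.map_one _).symm⟩

/-- **`hfrob` FAILS between columns `0` and `1` for EVERY admissible transport**: every
`Φ ∈ ⟨(Ind1) ∪ (Ind2)⟩` acts by signs, the sign-saturated `Ψ_v` absorbs it, and `Ψ_v ≠ {θ_v}`
(the negative translate `−θ_v` lies in `Ψ_v` and differs from `θ_v` since `p ≠ 0`). With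
`depthLattice_multiradialCompat`, the étale symmetry does NOT supply the cross-column Kummer
identification — row C-13's coricity cost is strictly extra data. [folklore] -/
theorem depth_not_frobCompat {Φ : signShells.PacketAut}
    (hΦ : Φ ∈ Subgroup.closure (signShells.Ind1Family ∪ signShells.Ind2Family)) :
    ¬ ∀ (m : ℤ) (v : toyIndex.V) (hv : v ∈ toyIndex.Vbad),
        signShells.starAut Φ v '' ((depthLattice p).col 0).frobΨ m v hv =
          ((depthLattice p).col 1).frobΨ m v hv := by
  intro h
  have h0 := h 0 () trivial
  rw [depthCol_zero_frobΨ p 0 () trivial, depthCol_one_frobΨ p 0 () trivial,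
    image_Psi_of_actsBySigns p (actsBySigns_of_mem_closure hΦ) ()] at h0
  -- `Ψ_v = {θ_v}`: refuted by the negative translate.
  have hneg : (fun j : toyIndex.LabelStar =>
      (line j.1 (toyIndex.over ())).symm (-((p : ℚ) ^ ((j.1 : ℕ) ^ 2)))) ∈ Psi p () :=
    fun _ => Or.inr (LinearEquiv.apply_symm_apply _ _)
  rw [h0] at hneg
  have heq : (fun j : toyIndex.LabelStar =>
      (line j.1 (toyIndex.over ())).symm (-((p : ℚ) ^ ((j.1 : ℕ) ^ 2)))) = thetaValues p () := hneg
  set j₀ : toyIndex.LabelStar := ⟨1, by decide⟩ with hj₀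
  have h1 := congrFun heq j₀
  have h2 := congrArg (line j₀.1 (toyIndex.over ())) h1
  simp only [thetaValues, LinearEquiv.apply_symm_apply] at h2
  have hq : (p : ℚ) ≠ 0 := Nat.cast_ne_zero.mpr hp.1.pos.ne'
  exact pow_ne_zero ((j₀.1 : ℕ) ^ 2) hq (by linarith [h2])

end Summit.ABC.IUTFork.Cor312Vol.NaiveWitness

end
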